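import Summits.RiemannHypothesis.RiemannHypothesis.Theorems.SemilocalNegCertEleven
import Summits.RiemannHypothesis.RiemannHypothesis.Theorems.SemilocalLogAtomsB
import Summits.RiemannHypothesis.RiemannHypothesis.Theorems.SemilocalLogAtomsC
import Summits.RiemannHypothesis.RiemannHypothesis.Theorems.SemilocalLogAtomsD
import Summits.RiemannHypothesis.RiemannHypothesis.Theorems.SemilocalLogAtomsE
import Summits.RiemannHypothesis.RiemannHypothesis.Theorems.SemilocalNegCertWide
import HarnessLib

/-!
# Semi-local threshold of the `{∞} ∪ {p < 59}` form, negative side: `a*({2,…,53}) ≤ 263/128` (the wall `q = 59`)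

Cell `rh-explicit` (HOME `run/shared/lean/pub/rh-explicit/`), seat cc-s2-4 gen9/gen12 (the SUB-WINDOW row of the wall `q = 59`: window below `(log 61)/2` so that the handoff upper clause at `q = 59` follows; HELD layout filed by gen12 since the LIGHT re-layout waits on the `SemilocalGridMoments` olean; `S = S_59 = {2, 3, 5, 7, 11, 13, 17, 19, 23, 29, 31, 37, 41, 43, 47, 53}`, class `2, …, 53 ∈ S ∌ 59`).  Honest framing: theorems about the tree's
`weilSemilocalThreshold S`; nothing here bears on RH.  No data is trusted: 14 kernel facts (`decide +kernel`) of the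
WIDE piecewise certificate (`SemilocalNegCertWide.lean`: scope `b ≤ 4`, majorant `archMajorWL 10 4 8 u₀` (sinh-minorant order 8: order 5 is NOT enough at 2b ≈ 4.1–4.3, CC4-LEAN §14.7), no polar credit),
`certUptoFiftyThree` (window `2b = 263 / 64`, bulk in 12 pieces).

Instance data: window `N = 62` (`2b < log 63`), atoms = the `S`-smooth prime powers `≤ 62`:
`2, 3, 4, 5, 7, 8, 9, 11, 13, 16, 17, 19, 23, 25, 27, 29, 31, 32, 37, 41, 43, 47, 49, 53` (enclosures `SemilocalLogAtoms{,B,C,D,E}.lean`).  Witness: bottom vector of the odd Legendre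
section `d = 17` at `b = 263/128` from this seat's exact-kappa finder (`polyfind.py`, HOME/cc-s2-4/gen7/): `Re Q_S(G)/‖G‖² =
−1.09·10⁻⁴ (LIGHT-layout kernel margin at KA = 8, cc-s2-4 gen9; finder polyfind_np NOPOLAR d 17)` ⇒ **`weilSemilocalThreshold {2, 3, 5, 7, 11, 13, 17, 19, 23, 29, 31, 37, 41, 43, 47, 53} ≤ 263/128`**.  The window sits just beyond the KNEE of the wall
(`b ≈ a*(S_59) + 0.01`: past it the finite-degree sections turn strongly negative and degree 17 suffices; closer to `a*`
the same witness class needs degree ≥ 25 — gen7, CC4-LEAN §12.5; knee table CC4-LEAN §13).  Locality (`N = 62`): **`a*(S) = a*(S_59) ∈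
[0.8046, 263/128]` for every finite `S ⊇ S_59` with `59, 61 ∉ S`** (DATA: a*(S_59) ∈ (2.038794, 2.038800] (cc6, N = 800)).  Folklore throughout.
-/

set_option autoImplicit false
set_option linter.dupNamespace false  -- the mandated namespace repeats `RiemannHypothesis`
set_option Elab.async false  -- serialise the kernel facts (cc-s2-4 gen11, CC4-LEAN §16.10)

noncomputable section

open Complex Filter Set MeasureTheory Topology
open scoped Real

namespace Summit.RiemannHypothesis.RiemannHypothesis.Theorems.SemilocalPolyWitness

open MeasureTheory Set Finset Real
open Literature.NumberTheory.LFunctions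
open Summit.RiemannHypothesis.RiemannHypothesis.Theorems.MotivicDoor
open Summit.RiemannHypothesis.RiemannHypothesis.Theorems.MotivicDoor.SemilocalThreshold
open Summit.RiemannHypothesis.RiemannHypothesis.Theorems.MotivicDoor.SemilocalMarkov
open LQ


/-! ### The atom table of the `{2, 3, 5, 7, 11, 13, 17, 19, 23, 29, 31, 37, 41, 43, 47, 53}`-form on windows `b < (log 63)/2` (`N = 62`) -/

/-- The atoms of the `{2, 3, 5, 7, 11, 13, 17, 19, 23, 29, 31, 37, 41, 43, 47, 53}`-form below `(log 63)/2`: `2, 3, 4, 5, 7, 8, 9, 11, 13, 16, 17, 19, 23, 25, 27, 29, 31, 32, 37, 41, 43, 47, 49, 53`. -/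
def atomsUptoFiftyThree : List (ℕ × AtomQ) := [atomTwo, atomThree, atomFour, atomFive, atomSeven, atomEight, atomNine, atomEleven, atomThirteen, atomSixteen, atomSeventeen, atomNineteen, atomTwentyThree, atomTwentyFive, atomTwentySeven, atomTwentyNine, atomThirtyOne, atomThirtyTwo, atomThirtySeven, atomFortyOne, atomFortyThree, atomFortySeven, atomFortyNine, atomFiftyThree]

/-- A rational lower bound of `log 63`. -/
def logSuccLoUptoFiftyThree : ℚ := 2 * logThreeLo + logSevenLo

/-- **The atom table encloses `({2, 3, 5, 7, 11, 13, 17, 19, 23, 29, 31, 37, 41, 43, 47, 53}, 62)`.** -/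
theorem atomsEnclose_UptoFiftyThree : AtomsEnclose {2, 3, 5, 7, 11, 13, 17, 19, 23, 29, 31, 37, 41, 43, 47, 53} 62 atomsUptoFiftyThree logSuccLoUptoFiftyThree where
  nodup := by decide
  lt_succ := by decide
  cover := by
    intro n hn hnot
    simp only [atomsUptoFiftyThree, atomTwo, atomThree, atomFour, atomFive, atomSeven, atomEight, atomNine, atomEleven, atomThirteen, atomSixteen, atomSeventeen, atomNineteen, atomTwentyThree, atomTwentyFive, atomTwentySeven, atomTwentyNine, atomThirtyOne, atomThirtyTwo, atomThirtySeven, atomFortyOne, atomFortyThree, atomFortySeven, atomFortyNine, atomFiftyThree, List.map_cons, List.map_nil, List.mem_cons,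
      List.not_mem_nil, or_false, not_or] at hnot
    have hn' : n < 63 := Finset.mem_range.1 hn
    interval_cases n
    · exact weilSemilocalCoeff_of_not_isPrimePow _ (by decide)
    · exact weilSemilocalCoeff_of_not_isPrimePow _ (by decide)
    · simp at hnot
    · simp at hnot
    · simp at hnot
    · simp at hnot
    · exact weilSemilocalCoeff_of_not_isPrimePow _ (by decide)
    · simp at hnot
    · simp at hnot
    · simp at hnot
    · exact weilSemilocalCoeff_of_not_isPrimePow _ (by decide)
    · simp at hnot
    · exact weilSemilocalCoeff_of_not_isPrimePow _ (by decide)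
    · simp at hnot
    · exact weilSemilocalCoeff_of_not_isPrimePow _ (by decide)
    · exact weilSemilocalCoeff_of_not_isPrimePow _ (not_isPrimePow_of_two_primes_dvd Nat.prime_three (by norm_num : Nat.Prime 5) (by norm_num) (by norm_num) (by norm_num))
    · simp at hnot
    · simp at hnot
    · exact weilSemilocalCoeff_of_not_isPrimePow _ (by decide)
    · simp at hnot
    · exact weilSemilocalCoeff_of_not_isPrimePow _ (by decide)
    · exact weilSemilocalCoeff_of_not_isPrimePow _ (not_isPrimePow_of_two_primes_dvd Nat.prime_three (by norm_num : Nat.Prime 7) (by norm_num) (by norm_num) (by norm_num))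
    · exact weilSemilocalCoeff_of_not_isPrimePow _ (by decide)
    · simp at hnot
    · exact weilSemilocalCoeff_of_not_isPrimePow _ (by decide)
    · simp at hnot
    · exact weilSemilocalCoeff_of_not_isPrimePow _ (by decide)
    · simp at hnot
    · exact weilSemilocalCoeff_of_not_isPrimePow _ (by decide)
    · simp at hnot
    · exact weilSemilocalCoeff_of_not_isPrimePow _ (by decide)
    · simp at hnot
    · simp at hnot
    · exact weilSemilocalCoeff_of_not_isPrimePow _ (not_isPrimePow_of_two_primes_dvd Nat.prime_three (by norm_num : Nat.Prime 11) (by norm_num) (by norm_num) (by norm_num))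
    · exact weilSemilocalCoeff_of_not_isPrimePow _ (by decide)
    · exact weilSemilocalCoeff_of_not_isPrimePow _ (not_isPrimePow_of_two_primes_dvd (by norm_num : Nat.Prime 5) (by norm_num : Nat.Prime 7) (by norm_num) (by norm_num) (by norm_num))
    · exact weilSemilocalCoeff_of_not_isPrimePow _ (by decide)
    · simp at hnot
    · exact weilSemilocalCoeff_of_not_isPrimePow _ (by decide)
    · exact weilSemilocalCoeff_of_not_isPrimePow _ (not_isPrimePow_of_two_primes_dvd Nat.prime_three (by norm_num : Nat.Prime 13) (by norm_num) (by norm_num) (by norm_num))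
    · exact weilSemilocalCoeff_of_not_isPrimePow _ (by decide)
    · simp at hnot
    · exact weilSemilocalCoeff_of_not_isPrimePow _ (by decide)
    · simp at hnot
    · exact weilSemilocalCoeff_of_not_isPrimePow _ (by decide)
    · exact weilSemilocalCoeff_of_not_isPrimePow _ (not_isPrimePow_of_two_primes_dvd Nat.prime_three (by norm_num : Nat.Prime 5) (by norm_num) (by norm_num) (by norm_num))
    · exact weilSemilocalCoeff_of_not_isPrimePow _ (by decide)
    · simp at hnot
    · exact weilSemilocalCoeff_of_not_isPrimePow _ (by decide)
    · simp at hnot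
    · exact weilSemilocalCoeff_of_not_isPrimePow _ (by decide)
    · exact weilSemilocalCoeff_of_not_isPrimePow _ (not_isPrimePow_of_two_primes_dvd Nat.prime_three (by norm_num : Nat.Prime 17) (by norm_num) (by norm_num) (by norm_num))
    · exact weilSemilocalCoeff_of_not_isPrimePow _ (by decide)
    · simp at hnot
    · exact weilSemilocalCoeff_of_not_isPrimePow _ (by decide)
    · exact weilSemilocalCoeff_of_not_isPrimePow _ (not_isPrimePow_of_two_primes_dvd (by norm_num : Nat.Prime 5) (by norm_num : Nat.Prime 11) (by norm_num) (by norm_num) (by norm_num))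
    · exact weilSemilocalCoeff_of_not_isPrimePow _ (by decide)
    · exact weilSemilocalCoeff_of_not_isPrimePow _ (not_isPrimePow_of_two_primes_dvd Nat.prime_three (by norm_num : Nat.Prime 19) (by norm_num) (by norm_num) (by norm_num))
    · exact weilSemilocalCoeff_of_not_isPrimePow _ (by decide)
    · exact weilSemilocalCoeff_prime_of_not_mem (by norm_num) (by decide)
    · exact weilSemilocalCoeff_of_not_isPrimePow _ (by decide)
    · exact weilSemilocalCoeff_prime_of_not_mem (by norm_num) (by decide)
    · exact weilSemilocalCoeff_of_not_isPrimePow _ (by decide)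
  encl := by
    intro na hna
    simp only [atomsUptoFiftyThree, List.mem_cons, List.not_mem_nil, or_false] at hna
    rcases hna with rfl | rfl | rfl | rfl | rfl | rfl | rfl | rfl | rfl | rfl | rfl | rfl | rfl | rfl | rfl | rfl | rfl | rfl | rfl | rfl | rfl | rfl | rfl | rfl
    · exact atomTwo_encl (by decide)
    · exact atomThree_encl (by decide)
    · exact atomFour_encl (by decide)
    · exact atomFive_encl (by decide)
    · exact atomSeven_encl (by decide)
    · exact atomEight_encl (by decide)
    · exact atomNine_encl (by decide)
    · exact atomEleven_encl (by decide)
    · exact atomThirteen_encl (by decide)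
    · exact atomSixteen_encl (by decide)
    · exact atomSeventeen_encl (by decide)
    · exact atomNineteen_encl (by decide)
    · exact atomTwentyThree_encl (by decide)
    · exact atomTwentyFive_encl (by decide)
    · exact atomTwentySeven_encl (by decide)
    · exact atomTwentyNine_encl (by decide)
    · exact atomThirtyOne_encl (by decide)
    · exact atomThirtyTwo_encl (by decide)
    · exact atomThirtySeven_encl (by decide)
    · exact atomFortyOne_encl (by decide)
    · exact atomFortyThree_encl (by decide)
    · exact atomFortySeven_encl (by decide)
    · exact atomFortyNine_encl (by decide)
    · exact atomFiftyThree_encl (by decide)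
  logSucc := by
    have h3 := logThreeLo_le
    have h7 := logSevenLo_le
    have h63 : Real.log (((62 : ℕ) : ℝ) + 1) = 2 * Real.log 3 + Real.log 7 := by
      rw [show ((62 : ℕ) : ℝ) + 1 = 3 ^ 2 * 7 by norm_num, Real.log_mul (by norm_num) (by norm_num), Real.log_pow]; push_cast; ring
    rw [h63, logSuccLoUptoFiftyThree]; push_cast; linarith

/-! ### The certificates -/

/-- The degree-17 witness at `b = 263 / 128` (bottom vector of the odd Legendre section d = 17 at b = 263/128, rounded to 10 digits; −1.09·10⁻⁴ (LIGHT-layout kernel margin at KA = 8, cc-s2-4 gen9; finder polyfind_np NOPOLAR d 17)), in powers of `x`. -/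
def pUptoFiftyThree : List ℚ :=
  [0, -747427946617995 / 67328, 0, 2339077507548121600 / 18191447, 0, -405792246887052094734336 / 1258284197543, 0, 29464127972633252713595928576 / 87034259659851767, 0, -1031704835443410188150507569152000 / 6020072706412286871623, 0, 17456387004855832614392156704418562048 / 416402409029831470623291287, 0, -109214069237127505929196430108049539072000 / 28802138230184412991542435030503, 0, -382134873501385502662445005871467625730539520 / 1992215099243625662211998688624862007, 0, 5483110174738873237747208598867770881307584757760 / 137799526199582343429541737293493080162183]

/-- The piecewise certificate at `b = 263 / 128`: orders `(nA, mA, KA, Kt, nt, ne) = (10, 4, 8, 10, 40, 16)`, cuts `[1, 3 / 2, 19 / 10, 11 / 5, 5 / 2, 57 / 20, 16 / 5, 173 / 50, 37 / 10, 39 / 10, 41 / 10, 263 / 64]`,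
claimed piece bounds and atom bound (exact rational values rounded up to integers). -/
def certUptoFiftyThree : WeilNegCertP :=
  ⟨pUptoFiftyThree, 263 / 128, 10, 4, 8, 10, 40, 16, atomsUptoFiftyThree, logSuccLoUptoFiftyThree,
   [1, 3 / 2, 19 / 10, 11 / 5, 5 / 2, 57 / 20, 16 / 5, 173 / 50, 37 / 10, 39 / 10, 41 / 10, 263 / 64],
   [241318942179883961540, 67060928338520849901, 34625913940516605327, 25710679386103022326, 16988517638202198732, 19014537218590442127, 12630300490852691548, 6672175054967168197, 8807073699303820722, 6465190248629644356, 5287305754258087547, 231557205329310624], 2366033941969335805657⟩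

set_option maxHeartbeats 0 in
/-- kernel fact: side conditions and the final inequality of `certUptoFiftyThree`. -/
theorem check_UptoFiftyThree_main : certUptoFiftyThree.checkMainW c0SharpQ = true := by
  decide +kernel

set_option maxHeartbeats 0 in
/-- kernel fact: the atom side of `certUptoFiftyThree`. -/
theorem check_UptoFiftyThree_atoms : certUptoFiftyThree.checkAtoms = true := by
  decide +kernel

set_option maxHeartbeats 0 in
/-- kernel fact: piece `0` of `certUptoFiftyThree`. -/
theorem check_UptoFiftyThree_piece0 : certUptoFiftyThree.checkPieceW 0 = true := by
  decide +kernel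

set_option maxHeartbeats 0 in
/-- kernel fact: piece `1` of `certUptoFiftyThree`. -/
theorem check_UptoFiftyThree_piece1 : certUptoFiftyThree.checkPieceW 1 = true := by
  decide +kernel

set_option maxHeartbeats 0 in
/-- kernel fact: piece `2` of `certUptoFiftyThree`. -/
theorem check_UptoFiftyThree_piece2 : certUptoFiftyThree.checkPieceW 2 = true := by
  decide +kernel

set_option maxHeartbeats 0 in
/-- kernel fact: piece `3` of `certUptoFiftyThree`. -/
theorem check_UptoFiftyThree_piece3 : certUptoFiftyThree.checkPieceW 3 = true := by
  decide +kernel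

set_option maxHeartbeats 0 in
/-- kernel fact: piece `4` of `certUptoFiftyThree`. -/
theorem check_UptoFiftyThree_piece4 : certUptoFiftyThree.checkPieceW 4 = true := by
  decide +kernel

set_option maxHeartbeats 0 in
/-- kernel fact: piece `5` of `certUptoFiftyThree`. -/
theorem check_UptoFiftyThree_piece5 : certUptoFiftyThree.checkPieceW 5 = true := by
  decide +kernel

set_option maxHeartbeats 0 in
/-- kernel fact: piece `6` of `certUptoFiftyThree`. -/
theorem check_UptoFiftyThree_piece6 : certUptoFiftyThree.checkPieceW 6 = true := by
  decide +kernel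

set_option maxHeartbeats 0 in
/-- kernel fact: piece `7` of `certUptoFiftyThree`. -/
theorem check_UptoFiftyThree_piece7 : certUptoFiftyThree.checkPieceW 7 = true := by
  decide +kernel

set_option maxHeartbeats 0 in
/-- kernel fact: piece `8` of `certUptoFiftyThree`. -/
theorem check_UptoFiftyThree_piece8 : certUptoFiftyThree.checkPieceW 8 = true := by
  decide +kernel

set_option maxHeartbeats 0 in
/-- kernel fact: piece `9` of `certUptoFiftyThree`. -/
theorem check_UptoFiftyThree_piece9 : certUptoFiftyThree.checkPieceW 9 = true := by
  decide +kernel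

set_option maxHeartbeats 0 in
/-- kernel fact: piece `10` of `certUptoFiftyThree`. -/
theorem check_UptoFiftyThree_piece10 : certUptoFiftyThree.checkPieceW 10 = true := by
  decide +kernel

set_option maxHeartbeats 0 in
/-- kernel fact: piece `11` of `certUptoFiftyThree`. -/
theorem check_UptoFiftyThree_piece11 : certUptoFiftyThree.checkPieceW 11 = true := by
  decide +kernel

/-- all pieces of `certUptoFiftyThree` check. -/
theorem check_UptoFiftyThree_pieces : ∀ i, i < certUptoFiftyThree.cuts.length → certUptoFiftyThree.checkPieceW i = true := by
  intro i hi
  have hi' : i < 12 := hi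
  interval_cases i
  · exact check_UptoFiftyThree_piece0
  · exact check_UptoFiftyThree_piece1
  · exact check_UptoFiftyThree_piece2
  · exact check_UptoFiftyThree_piece3
  · exact check_UptoFiftyThree_piece4
  · exact check_UptoFiftyThree_piece5
  · exact check_UptoFiftyThree_piece6
  · exact check_UptoFiftyThree_piece7
  · exact check_UptoFiftyThree_piece8
  · exact check_UptoFiftyThree_piece9
  · exact check_UptoFiftyThree_piece10
  · exact check_UptoFiftyThree_piece11

/-! ### The theorems -/

/-- **`a*({2,…,53}) ≤ 263/128`.** -/
theorem weilSemilocalThreshold_uptoFiftyThree_le :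
    weilSemilocalThreshold {2, 3, 5, 7, 11, 13, 17, 19, 23, 29, 31, 37, 41, 43, 47, 53} ≤ ((263 / 128 : ℚ) : ℝ) :=
  weilSemilocalThreshold_le_of_checkW_sharp certUptoFiftyThree atomsEnclose_UptoFiftyThree
    check_UptoFiftyThree_main check_UptoFiftyThree_atoms check_UptoFiftyThree_pieces

/-- Failure form: positivity of the `{∞} ∪ S_59` form fails on every cone `C(B)`, `B > 263/128`. -/
theorem not_weilSemilocalPositivityOn_uptoFiftyThree_of_gt {B : ℝ} (hB : (263 / 128 : ℝ) < B) :
    ¬ WeilSemilocalPositivityOn {2, 3, 5, 7, 11, 13, 17, 19, 23, 29, 31, 37, 41, 43, 47, 53} B := by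
  rw [not_weilSemilocalPositivityOn_iff_weilSemilocalThreshold_lt]
  have h := weilSemilocalThreshold_uptoFiftyThree_le
  push_cast at h
  linarith

/-- `a*({2,…,53}) < (log 63)/2`: below the window of the next index. -/
theorem weilSemilocalThreshold_uptoFiftyThree_lt_log_sixtythree_half :
    weilSemilocalThreshold {2, 3, 5, 7, 11, 13, 17, 19, 23, 29, 31, 37, 41, 43, 47, 53} < Real.log 63 / 2 := by
  have h := weilSemilocalThreshold_uptoFiftyThree_le
  have e : Real.log 63 = 2 * Real.log 3 + Real.log 7 := by
    rw [show (63 : ℝ) = 3 ^ 2 * 7 by norm_num, Real.log_mul (by norm_num) (by norm_num), Real.log_pow]; push_cast; ring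
  have h3 := logThreeLo_le
  rw [logThreeLo] at h3
  push_cast at h3
  have h7 := log_seven_gt_d11
  push_cast at h
  rw [e]
  linarith

/-- **The class `2, …, 53 ∈ S ∌ 59, 61`**: `a*(S) = a*({2,…,53})` (locality at `N = 62`). -/
theorem weilSemilocalThreshold_eq_uptoFiftyThree {S : Finset ℕ} (h2 : 2 ∈ S) (h3 : 3 ∈ S) (h5 : 5 ∈ S) (h7 : 7 ∈ S) (h11 : 11 ∈ S) (h13 : 13 ∈ S) (h17 : 17 ∈ S) (h19 : 19 ∈ S) (h23 : 23 ∈ S) (h29 : 29 ∈ S) (h31 : 31 ∈ S) (h37 : 37 ∈ S) (h41 : 41 ∈ S) (h43 : 43 ∈ S) (h47 : 47 ∈ S) (h53 : 53 ∈ S)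
    (h59 : 59 ∉ S) (h61 : 61 ∉ S) : weilSemilocalThreshold S = weilSemilocalThreshold {2, 3, 5, 7, 11, 13, 17, 19, 23, 29, 31, 37, 41, 43, 47, 53} := by
  refine weilSemilocalThreshold_congr (S := {2, 3, 5, 7, 11, 13, 17, 19, 23, 29, 31, 37, 41, 43, 47, 53}) (S' := S) (N := 62) ?_ ?_
  · intro n hn hpp
    interval_cases n
    · exact absurd hpp (by decide)
    · exact absurd hpp (by decide)
    · rw [Nat.prime_two.primeFactors]; simp [h2]
    · rw [Nat.prime_three.primeFactors]; simp [h3]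
    · rw [show (4 : ℕ) = 2 ^ 2 by norm_num, Nat.primeFactors_prime_pow two_ne_zero Nat.prime_two]; simp [h2]
    · rw [(by norm_num : Nat.Prime 5).primeFactors]; simp [h5]
    · exact absurd hpp (by decide)
    · rw [(by norm_num : Nat.Prime 7).primeFactors]; simp [h7]
    · rw [show (8 : ℕ) = 2 ^ 3 by norm_num, Nat.primeFactors_prime_pow (by norm_num) Nat.prime_two]; simp [h2]
    · rw [show (9 : ℕ) = 3 ^ 2 by norm_num, Nat.primeFactors_prime_pow two_ne_zero Nat.prime_three]; simp [h3]
    · exact absurd hpp (by decide)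
    · rw [(by norm_num : Nat.Prime 11).primeFactors]; simp [h11]
    · exact absurd hpp (by decide)
    · rw [(by norm_num : Nat.Prime 13).primeFactors]; simp [h13]
    · exact absurd hpp (by decide)
    · exact absurd hpp (not_isPrimePow_of_two_primes_dvd Nat.prime_three (by norm_num : Nat.Prime 5) (by norm_num)
        (by norm_num) (by norm_num))
    · rw [show (16 : ℕ) = 2 ^ 4 by norm_num, Nat.primeFactors_prime_pow (by norm_num) Nat.prime_two]; simp [h2]
    · rw [(by norm_num : Nat.Prime 17).primeFactors]; simp [h17]
    · exact absurd hpp (by decide)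
    · rw [(by norm_num : Nat.Prime 19).primeFactors]; simp [h19]
    · exact absurd hpp (by decide)
    · exact absurd hpp (not_isPrimePow_of_two_primes_dvd Nat.prime_three (by norm_num : Nat.Prime 7) (by norm_num)
        (by norm_num) (by norm_num))
    · exact absurd hpp (by decide)
    · rw [(by norm_num : Nat.Prime 23).primeFactors]; simp [h23]
    · exact absurd hpp (by decide)
    · rw [show (25 : ℕ) = 5 ^ 2 by norm_num, Nat.primeFactors_prime_pow two_ne_zero (by norm_num : Nat.Prime 5)]; simp [h5]
    · exact absurd hpp (by decide)
    · rw [show (27 : ℕ) = 3 ^ 3 by norm_num, Nat.primeFactors_prime_pow (by norm_num) Nat.prime_three]; simp [h3]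
    · exact absurd hpp (by decide)
    · rw [(by norm_num : Nat.Prime 29).primeFactors]; simp [h29]
    · exact absurd hpp (by decide)
    · rw [(by norm_num : Nat.Prime 31).primeFactors]; simp [h31]
    · rw [show (32 : ℕ) = 2 ^ 5 by norm_num, Nat.primeFactors_prime_pow (by norm_num) Nat.prime_two]; simp [h2]
    · exact absurd hpp (not_isPrimePow_of_two_primes_dvd Nat.prime_three (by norm_num : Nat.Prime 11) (by norm_num)
        (by norm_num) (by norm_num))
    · exact absurd hpp (by decide)
    · exact absurd hpp (not_isPrimePow_of_two_primes_dvd (by norm_num : Nat.Prime 5) (by norm_num : Nat.Prime 7) (by norm_num)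
        (by norm_num) (by norm_num))
    · exact absurd hpp (by decide)
    · rw [(by norm_num : Nat.Prime 37).primeFactors]; simp [h37]
    · exact absurd hpp (by decide)
    · exact absurd hpp (not_isPrimePow_of_two_primes_dvd Nat.prime_three (by norm_num : Nat.Prime 13) (by norm_num)
        (by norm_num) (by norm_num))
    · exact absurd hpp (by decide)
    · rw [(by norm_num : Nat.Prime 41).primeFactors]; simp [h41]
    · exact absurd hpp (by decide)
    · rw [(by norm_num : Nat.Prime 43).primeFactors]; simp [h43]
    · exact absurd hpp (by decide)
    · exact absurd hpp (not_isPrimePow_of_two_primes_dvd Nat.prime_three (by norm_num : Nat.Prime 5) (by norm_num)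
        (by norm_num) (by norm_num))
    · exact absurd hpp (by decide)
    · rw [(by norm_num : Nat.Prime 47).primeFactors]; simp [h47]
    · exact absurd hpp (by decide)
    · rw [show (49 : ℕ) = 7 ^ 2 by norm_num, Nat.primeFactors_prime_pow two_ne_zero (by norm_num : Nat.Prime 7)]; simp [h7]
    · exact absurd hpp (by decide)
    · exact absurd hpp (not_isPrimePow_of_two_primes_dvd Nat.prime_three (by norm_num : Nat.Prime 17) (by norm_num)
        (by norm_num) (by norm_num))
    · exact absurd hpp (by decide)
    · rw [(by norm_num : Nat.Prime 53).primeFactors]; simp [h53]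
    · exact absurd hpp (by decide)
    · exact absurd hpp (not_isPrimePow_of_two_primes_dvd (by norm_num : Nat.Prime 5) (by norm_num : Nat.Prime 11) (by norm_num)
        (by norm_num) (by norm_num))
    · exact absurd hpp (by decide)
    · exact absurd hpp (not_isPrimePow_of_two_primes_dvd Nat.prime_three (by norm_num : Nat.Prime 19) (by norm_num)
        (by norm_num) (by norm_num))
    · exact absurd hpp (by decide)
    · rw [(by norm_num : Nat.Prime 59).primeFactors]; simp [h59]
    · exact absurd hpp (by decide)
    · rw [(by norm_num : Nat.Prime 61).primeFactors]; simp [h61]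
    · exact absurd hpp (by decide)
  · have h := weilSemilocalThreshold_uptoFiftyThree_lt_log_sixtythree_half
    norm_num
    exact h

/-- **`a*(S) ≤ 263/128` for every finite set of primes `S` with `2, …, 53 ∈ S`, `59, 61 ∉ S`.** -/
theorem weilSemilocalThreshold_le_of_mem_fiftythree {S : Finset ℕ} (h2 : 2 ∈ S) (h3 : 3 ∈ S) (h5 : 5 ∈ S) (h7 : 7 ∈ S) (h11 : 11 ∈ S) (h13 : 13 ∈ S) (h17 : 17 ∈ S) (h19 : 19 ∈ S) (h23 : 23 ∈ S) (h29 : 29 ∈ S) (h31 : 31 ∈ S) (h37 : 37 ∈ S) (h41 : 41 ∈ S) (h43 : 43 ∈ S) (h47 : 47 ∈ S) (h53 : 53 ∈ S)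
    (h59 : 59 ∉ S) (h61 : 61 ∉ S) : weilSemilocalThreshold S ≤ ((263 / 128 : ℚ) : ℝ) := by
  rw [weilSemilocalThreshold_eq_uptoFiftyThree h2 h3 h5 h7 h11 h13 h17 h19 h23 h29 h31 h37 h41 h43 h47 h53 h59 h61]
  exact weilSemilocalThreshold_uptoFiftyThree_le

/-- **The bracket of the class `2, …, 53 ∈ S ∌ 59, 61`**: `4023/5000 ≤ a*(S) ≤ 263/128` (DATA `a*(S_59) ≈ 2.038800`). -/
theorem weilSemilocalThreshold_mem_Icc_of_mem_fiftythree {S : Finset ℕ} (h2 : 2 ∈ S) (h3 : 3 ∈ S) (h5 : 5 ∈ S) (h7 : 7 ∈ S) (h11 : 11 ∈ S) (h13 : 13 ∈ S) (h17 : 17 ∈ S) (h19 : 19 ∈ S) (h23 : 23 ∈ S) (h29 : 29 ∈ S) (h31 : 31 ∈ S) (h37 : 37 ∈ S) (h41 : 41 ∈ S) (h43 : 43 ∈ S) (h47 : 47 ∈ S) (h53 : 53 ∈ S)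
    (h59 : 59 ∉ S) (h61 : 61 ∉ S) : weilSemilocalThreshold S ∈ Set.Icc (4023 / 5000 : ℝ) ((263 / 128 : ℚ) : ℝ) :=
  ⟨SemilocalTwoThree.le_weilSemilocalThreshold_of_two_three_8046 h2 h3,
    weilSemilocalThreshold_le_of_mem_fiftythree h2 h3 h5 h7 h11 h13 h17 h19 h23 h29 h31 h37 h41 h43 h47 h53 h59 h61⟩

end Summit.RiemannHypothesis.RiemannHypothesis.Theorems.SemilocalPolyWitness

end
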